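import Mathlib
import Summits.NavierStokesRegularity.NavierStokesRegularity.Theorems.TaoLadderRungThreeTargetTableScaling
import Summits.NavierStokesRegularity.NavierStokesRegularity.Theorems.TaoLadderRungTwoBreakBlowupRigidityOneLiveTables
import HarnessLib

/-!
# Robust blow-up is 0-homogeneous in the datum: `NoGlobalCascade ε₀ α (c·X₀) ↔ NoGlobalCascade ε₀ α X₀` (`c > 0`),
  so K2(1) `TaoLadderRungTwoBreak.BlowupRigidityOne` (stmt-NavierStokesRegularity-20206) and the rung leaf
  `Target` may be decided on UNIT data `‖X₀‖ = 1`

MODEL lattice ODEs only (Tao 2016 §4 Lemma 4.1 (4.5)–(4.11), Thm. 4.2 statement shape); nothing here is a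
statement about the Navier–Stokes equations; NO item is closed (`--supports stmt-NavierStokesRegularity-20206`).
General `m` (`m = 4` in the by-name corollaries); DEF-FREE.

The quadratic lattice has the AMPLITUDE symmetry `X ↦ cX`, table `α ↦ c⁻¹α` at fixed time, and the tree's
TABLE-SCALING covariance (`RungThreeTaoMechanism.cascadeFrom_tableScale`, `noGlobalCascade_tableScale`: table
`c·α` ↔ `α` by the time change `t ↦ c⁻¹t`, budgets `(K₁,K₂) ↦ (K₁c⁻¹, K₂c⁻¹)`). Composing the two:

* `quadTerm_ampScale` — `quadTerm α (cX) = c² quadTerm α X`;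
* `cascadeFrom_ampScale` — a global `(K₁,K₂)`-pseudo-solution `(X,E)` for the table `c·α` from `X₀` gives the
  global `(K₁,K₂)`-pseudo-solution `(cX, c²E)` for `α` from `c·X₀` (SAME budgets, same clock: the defect (4.8), the
  energy inequality (4.9) and the envelope (4.10) are homogeneous of degrees 1, 3 (`= 2+1`) and 2);
* `hasGlobal_ampScale`, `noGlobalCascade_table_datum` — hence `HasGlobal (c·α) K₁ K₂ n₀ X₀ → HasGlobal α K₁ K₂ n₀ (c·X₀)`
  and `NoGlobalCascade ε₀ α (c·X₀) ↔ NoGlobalCascade ε₀ (c·α) X₀`;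
* `noGlobalCascade_datumScale_iff` — **with the table scaling: `NoGlobalCascade ε₀ α (c·X₀) ↔ NoGlobalCascade ε₀ α X₀`**
  for every `c > 0`: robustness of blow-up (no global pseudo-solution for SOME positive budget, `noGlobalCascade_iff_kappa`)
  does not see the size of the one-shell datum — the dimensionless datum of the problem is `X₀/‖X₀‖` (and the
  scale ratio, the table);
* `blowupRigidityOne_iff_unitData`, `target_iff_unitData` — BY NAME: K2(1) and the rung leaf `Target` are
  equivalent to their restrictions to data on the unit sphere `‖X₀‖ = 1` of `ℝ⁴` (sup norm); with
  `blowupRigidityOne_iff_live` the parameter space of either statement at fixed `(R, ε₀)` is the COMPACT set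
  `{α ∈ E₂(R), fluxConst α ≥ R⁻¹} × {‖X₀‖ = 1}`.

HONEST LABEL: symmetry bookkeeping (a normal form for the planner); no stub, crux or summit is proved; rung 0.
-/

noncomputable section

-- the summit and its single sub-problem share the name (CONVENTIONS §1)
set_option linter.dupNamespace false

open Set Filter Topology MeasureTheory intervalIntegral

namespace Summit.NavierStokesRegularity.NavierStokesRegularity.Theorems

namespace BlowupRigidityOne

open Literature.Analysis.FluidPDE Literature.Analysis.FluidPDE.TaoCascade
open Summit.NavierStokesRegularity.NavierStokesRegularity.Theses.TaoLadderRungTwoBreak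
open Summit.NavierStokesRegularity.NavierStokesRegularity.Theorems.RungThreeTaoMechanism

variable {m : ℕ}

/-! ## Amplitude scaling of pseudo-solutions -/

/-- The cascade nonlinearity is quadratic in the family: `quadTerm α (cX) = c² · quadTerm α X`.
[cite: Tao2016AveragedNS, §4 (4.8)] -/
theorem quadTerm_ampScale (ε₀ c : ℝ) (α : Fin m → Fin m → Fin m → ℤ × ℤ × ℤ → ℝ)
    (X : Fin m → ℤ → ℝ → ℝ) (i : Fin m) (n : ℤ) (t : ℝ) :
    quadTerm ε₀ α (fun j k s => c * X j k s) i n t = c ^ 2 * quadTerm ε₀ α X i n t := by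
  simp only [quadTerm, Finset.mul_sum]
  refine Finset.sum_congr rfl fun i₁ _ => Finset.sum_congr rfl fun i₂ _ =>
    Finset.sum_congr rfl fun μ _ => ?_
  ring

/-- **AMPLITUDE-SCALING COVARIANCE (no time change).** A global family obeying the conclusions (4.5)–(4.11)
of Lemma 4.1 for the scaled table `c·α` (`c > 0`) from the datum `X₀` at shell `n₀` with budgets `(K₁,K₂)`
yields, by `(X,E) ↦ (cX, c²E)`, one for the table `α` from the datum `c·X₀` with the SAME budgets.
[cite: Tao2016AveragedNS, §4 Lemma 4.1 (4.5)–(4.11)] -/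
theorem cascadeFrom_ampScale {ε₀ : ℝ} (hε : 0 < ε₀)
    {α : Fin m → Fin m → Fin m → ℤ × ℤ × ℤ → ℝ} {c K₁ K₂ : ℝ} (hc : 0 < c) {n₀ : ℤ}
    {X₀ : Fin m → ℝ} {X E : Fin m → ℤ → ℝ → ℝ}
    (h : CascadeODESolutionFrom ε₀ (fun a b d μ => c * α a b d μ) K₁ K₂ n₀ X₀ X E) :
    CascadeODESolutionFrom ε₀ α K₁ K₂ n₀ (fun i => c * X₀ i) (fun i n t => c * X i n t)
      (fun i n t => c ^ 2 * E i n t) := by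
  have hB : 0 < 1 + ε₀ := by linarith
  have hc2 : 0 < c ^ 2 := by positivity
  have hsq : ∀ x : ℝ, 0 ≤ x → Real.sqrt (c ^ 2 * x) = c * Real.sqrt x := fun x hx => by
    rw [Real.sqrt_mul (sq_nonneg c), Real.sqrt_sq hc.le]
  exact
  { contDiffOn_X := fun i n => contDiffOn_const.mul (h.contDiffOn_X i n)
    contDiffOn_E := fun i n => contDiffOn_const.mul (h.contDiffOn_E i n)
    nonneg_E := fun i n t ht => mul_nonneg hc2.le (h.nonneg_E i n t ht)
    apriori_X := by
      intro T hT
      obtain ⟨M, hM⟩ := h.apriori_X T hT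
      refine ⟨c * M, fun t ht i n => ?_⟩
      have hw : 0 ≤ 1 + (1 + ε₀) ^ ((10 : ℝ) * n) := add_nonneg zero_le_one (Real.rpow_nonneg hB.le _)
      rw [abs_mul, abs_of_pos hc]
      calc (1 + (1 + ε₀) ^ ((10 : ℝ) * n)) * (c * |X i n t|)
          = c * ((1 + (1 + ε₀) ^ ((10 : ℝ) * n)) * |X i n t|) := by ring
        _ ≤ c * M := mul_le_mul_of_nonneg_left (hM t ht i n) hc.le
    apriori_E := by
      intro T hT
      obtain ⟨M, hM⟩ := h.apriori_E T hT
      refine ⟨c * M, fun t ht i n => ?_⟩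
      rw [hsq _ (h.nonneg_E i n t ht.1)]
      calc (1 + (1 + ε₀) ^ ((10 : ℝ) * n)) * (c * Real.sqrt (E i n t))
          = c * ((1 + (1 + ε₀) ^ ((10 : ℝ) * n)) * Real.sqrt (E i n t)) := by ring
        _ ≤ c * M := mul_le_mul_of_nonneg_left (hM t ht i n) hc.le
    init_E := fun i n => by rw [h.init_E i n]; ring
    init_X := fun i n => by
      rw [h.init_X i n]
      split_ifs <;> simp
    motion := by
      intro i n t ht
      have hd : HasDerivWithinAt (X i n) (derivWithin (X i n) (Ici 0) t) (Ici 0) t :=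
        (((h.contDiffOn_X i n).differentiableOn one_ne_zero) t (mem_Ici.2 ht)).hasDerivWithinAt
      have hD : derivWithin (fun s => c * X i n s) (Ici 0) t = c * derivWithin (X i n) (Ici 0) t :=
        (hd.const_mul c).derivWithin (uniqueDiffOn_Ici 0 t (mem_Ici.2 ht))
      have hm := h.motion i n t ht
      rw [quadTerm_tableScale] at hm
      rw [hD, quadTerm_ampScale, hsq _ (h.nonneg_E i n t ht),
        show c * derivWithin (X i n) (Ici 0) t - c ^ 2 * quadTerm ε₀ α X i n t
            = c * (derivWithin (X i n) (Ici 0) t - c * quadTerm ε₀ α X i n t) by ring,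
        abs_mul, abs_of_pos hc]
      calc c * |derivWithin (X i n) (Ici 0) t - c * quadTerm ε₀ α X i n t|
          ≤ c * (K₁ * (1 + ε₀) ^ ((2 : ℝ) * n) * Real.sqrt (E i n t)) :=
            mul_le_mul_of_nonneg_left hm hc.le
        _ = K₁ * (1 + ε₀) ^ ((2 : ℝ) * n) * (c * Real.sqrt (E i n t)) := by ring
    energy := by
      intro i n t ht
      have hd : HasDerivWithinAt (E i n) (derivWithin (E i n) (Ici 0) t) (Ici 0) t :=
        (((h.contDiffOn_E i n).differentiableOn one_ne_zero) t (mem_Ici.2 ht)).hasDerivWithinAt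
      have hD : derivWithin (fun s => c ^ 2 * E i n s) (Ici 0) t = c ^ 2 * derivWithin (E i n) (Ici 0) t :=
        (hd.const_mul (c ^ 2)).derivWithin (uniqueDiffOn_Ici 0 t (mem_Ici.2 ht))
      have he := h.energy i n t ht
      rw [quadTerm_tableScale] at he
      rw [hD, quadTerm_ampScale]
      calc c ^ 2 * derivWithin (E i n) (Ici 0) t
          ≤ c ^ 2 * (c * quadTerm ε₀ α X i n t * X i n t) := mul_le_mul_of_nonneg_left he hc2.le
        _ = c ^ 2 * quadTerm ε₀ α X i n t * (c * X i n t) := by ring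
    defect_lower := by
      intro i n t ht
      have hl := h.defect_lower i n t ht
      calc 1 / 2 * (c * X i n t) ^ 2 = c ^ 2 * (1 / 2 * X i n t ^ 2) := by ring
        _ ≤ c ^ 2 * E i n t := mul_le_mul_of_nonneg_left hl hc2.le
    defect_upper := by
      intro i n t ht
      have hu := h.defect_upper i n t ht
      have hint : ∫ s in (0 : ℝ)..t, c ^ 2 * E i n s = c ^ 2 * ∫ s in (0 : ℝ)..t, E i n s :=
        intervalIntegral.integral_const_mul _ _
      rw [hint]
      calc c ^ 2 * E i n t
          ≤ c ^ 2 * (1 / 2 * X i n t ^ 2 + K₂ * (1 + ε₀) ^ ((2 : ℝ) * n) * ∫ s in (0 : ℝ)..t, E i n s) :=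
            mul_le_mul_of_nonneg_left hu hc2.le
        _ = 1 / 2 * (c * X i n t) ^ 2 +
              K₂ * (1 + ε₀) ^ ((2 : ℝ) * n) * (c ^ 2 * ∫ s in (0 : ℝ)..t, E i n s) := by ring
    noLow_X := fun i n t hn ht => by rw [h.noLow_X i n t hn ht, mul_zero]
    noLow_E := fun i n t hn ht => by rw [h.noLow_E i n t hn ht, mul_zero] }

/-- `HasGlobal` form of `cascadeFrom_ampScale`: `HasGlobal ε₀ (c·α) K₁ K₂ n₀ X₀ → HasGlobal ε₀ α K₁ K₂ n₀ (c·X₀)`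
(`c > 0`). [cite: Tao2016AveragedNS, §4 Lemma 4.1 (4.5)–(4.11); cell vocabulary (`HasGlobal`)] -/
theorem hasGlobal_ampScale {ε₀ : ℝ} (hε : 0 < ε₀)
    {α : Fin m → Fin m → Fin m → ℤ × ℤ × ℤ → ℝ} {c K₁ K₂ : ℝ} (hc : 0 < c) {n₀ : ℤ}
    {X₀ : Fin m → ℝ} (h : HasGlobal ε₀ (fun a b d μ => c * α a b d μ) K₁ K₂ n₀ X₀) :
    HasGlobal ε₀ α K₁ K₂ n₀ (fun i => c * X₀ i) := by
  obtain ⟨X, E, hXE⟩ := h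
  exact ⟨_, _, cascadeFrom_ampScale hε hc hXE⟩

/-- **Datum scaling = table scaling**: `NoGlobalCascade ε₀ α (c·X₀) ↔ NoGlobalCascade ε₀ (c·α) X₀` (`c > 0`) — the
amplitude map `(X,E) ↦ (cX, c²E)` and its inverse exchange global pseudo-solutions of `α` from `c·X₀` with those of
`c·α` from `X₀` at the same budgets and starting shell.
[cite: Tao2016AveragedNS, §4 Thm. 4.2 (statement shape); cell vocabulary (`NoGlobalCascade`)] -/
theorem noGlobalCascade_table_datum {ε₀ : ℝ} (hε : 0 < ε₀)
    {α : Fin m → Fin m → Fin m → ℤ × ℤ × ℤ → ℝ} {X₀ : Fin m → ℝ} {c : ℝ} (hc : 0 < c) :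
    NoGlobalCascade ε₀ α (fun i => c * X₀ i) ↔ NoGlobalCascade ε₀ (fun a b d μ => c * α a b d μ) X₀ := by
  constructor
  · intro h K₁ K₂ hK₁ hK₂
    obtain ⟨N₀, hN₀⟩ := h K₁ K₂ hK₁ hK₂
    exact ⟨N₀, fun n₀ hn₀ hG => hN₀ n₀ hn₀ (hasGlobal_ampScale hε hc hG)⟩
  · intro h K₁ K₂ hK₁ hK₂
    obtain ⟨N₀, hN₀⟩ := h K₁ K₂ hK₁ hK₂
    refine ⟨N₀, fun n₀ hn₀ hG => hN₀ n₀ hn₀ ?_⟩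
    -- pull an `α`-solution from `c·X₀` back to a `(c·α)`-solution from `X₀` with the scalar `c⁻¹`
    have hc' : 0 < c⁻¹ := inv_pos.2 hc
    have hα : (fun a b d μ => c⁻¹ * ((fun a b d μ => c * α a b d μ) a b d μ)) = α := by
      funext a b d μ
      rw [← mul_assoc, inv_mul_cancel₀ hc.ne', one_mul]
    have hX : (fun i => c⁻¹ * ((fun i => c * X₀ i) i)) = X₀ := by
      funext i
      rw [← mul_assoc, inv_mul_cancel₀ hc.ne', one_mul]
    have hG' : HasGlobal ε₀ (fun a b d μ => c⁻¹ * ((fun a b d μ => c * α a b d μ) a b d μ)) K₁ K₂ n₀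
        (fun i => c * X₀ i) := by rw [hα]; exact hG
    have := hasGlobal_ampScale (α := fun a b d μ => c * α a b d μ) hε hc' hG'
    rwa [hX] at this

/-- **ROBUST BLOW-UP IS 0-HOMOGENEOUS IN THE DATUM**: `NoGlobalCascade ε₀ α (c·X₀) ↔ NoGlobalCascade ε₀ α X₀` for every
`c > 0` (datum scaling = table scaling `noGlobalCascade_table_datum`, and Theorem 4.2-level blow-up is invariant under
table scaling, `noGlobalCascade_tableScale`, because it quantifies over all defect budgets).
[cite: Tao2016AveragedNS, §4 Thm. 4.2 (statement shape), Lemma 4.1; cell vocabulary (`NoGlobalCascade`)] -/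
theorem noGlobalCascade_datumScale_iff {ε₀ : ℝ} (hε : 0 < ε₀)
    {α : Fin m → Fin m → Fin m → ℤ × ℤ × ℤ → ℝ} {X₀ : Fin m → ℝ} {c : ℝ} (hc : 0 < c) :
    NoGlobalCascade ε₀ α (fun i => c * X₀ i) ↔ NoGlobalCascade ε₀ α X₀ := by
  rw [noGlobalCascade_table_datum hε hc]
  constructor
  · intro h
    have hα : (fun a b d μ => c⁻¹ * ((fun a b d μ => c * α a b d μ) a b d μ)) = α := by
      funext a b d μ
      rw [← mul_assoc, inv_mul_cancel₀ hc.ne', one_mul]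
    have := noGlobalCascade_tableScale hε (inv_pos.2 hc) h
    rwa [hα] at this
  · exact noGlobalCascade_tableScale hε hc

/-! ## By name: K2(1) and the rung leaf on unit data -/

/-- The normalised datum `‖X₀‖⁻¹ · X₀` of a non-zero datum has (sup) norm `1`. [folklore] -/
theorem norm_normalise_eq_one {X₀ : Fin m → ℝ} (hX₀ : X₀ ≠ 0) : ‖fun i => ‖X₀‖⁻¹ * X₀ i‖ = 1 := by
  have h : (fun i => ‖X₀‖⁻¹ * X₀ i) = ‖X₀‖⁻¹ • X₀ := by
    funext i
    simp [Pi.smul_apply, smul_eq_mul]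
  rw [h, norm_smul, norm_inv, norm_norm, inv_mul_cancel₀ (norm_ne_zero_iff.2 hX₀)]

/-- **K2(1) ⟺ K2(1) ON UNIT DATA.** `BlowupRigidityOne` is equivalent to the same implication demanded only of data
with `‖X₀‖ = 1`: a robust datum is non-zero (`not_noGlobalCascade_of_datum_zero`) and its normalisation is robust
(`noGlobalCascade_datumScale_iff`), while the conclusion (a surviving non-trivial DSS wave of `α`) does not mention
the datum. [cite: Tao2016AveragedNS, §4 Thm. 4.2 (statement shape); cell vocabulary (K2(1))] -/
theorem blowupRigidityOne_iff_unitData :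
    BlowupRigidityOne ↔
      ∀ R : ℝ, 1 ≤ R → ∃ εs : ℝ, 0 < εs ∧ ∀ ε₀ : ℝ, 0 < ε₀ → ε₀ ≤ εs →
        ∀ (α : Fin 4 → Fin 4 → Fin 4 → ℤ × ℤ × ℤ → ℝ) (X₀ : Fin 4 → ℝ),
          InTableClass R α → ‖X₀‖ = 1 → NoGlobalCascade ε₀ α X₀ →
            ∃ (q : ℕ) (π : Equiv.Perm (Fin q)) (T : ℝ) (Φ : Fin q → ℝ → Em 4),
              IsDSSWave ε₀ α π T Φ ∧ Surviving 1 ε₀ T ∧ ∃ r x, Φ r x ≠ 0 := by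
  constructor
  · intro h R hR
    obtain ⟨εs, hεs, H⟩ := h R hR
    exact ⟨εs, hεs, fun ε₀ hε hle α X₀ hα _ hNG => H ε₀ hε hle α X₀ hα hNG⟩
  · intro h R hR
    obtain ⟨εs, hεs, H⟩ := h R hR
    refine ⟨εs, hεs, fun ε₀ hε hle α X₀ hα hNG => ?_⟩
    have hX₀ : X₀ ≠ 0 := (live_of_noGlobalCascade hε hα hNG).2
    have hpos : 0 < ‖X₀‖⁻¹ := inv_pos.2 (norm_pos_iff.2 hX₀)
    exact H ε₀ hε hle α (fun i => ‖X₀‖⁻¹ * X₀ i) hα (norm_normalise_eq_one hX₀)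
      ((noGlobalCascade_datumScale_iff hε hpos).2 hNG)

/-- **The rung leaf ⟺ the rung leaf ON UNIT DATA.** `Target` (below `ε_R` no table of `E₂(R)` blows up robustly from a
one-shell datum) is equivalent to the same statement for data with `‖X₀‖ = 1`.
[cite: Tao2016AveragedNS, §4 Thm. 4.2 (statement shape); cell vocabulary (`Target` = `RungTwoBreakLatt`)] -/
theorem target_iff_unitData :
    Target ↔
      ∀ R : ℝ, 1 ≤ R → ∃ εR : ℝ, 0 < εR ∧ ∀ ε₀ : ℝ, 0 < ε₀ → ε₀ ≤ εR →
        ∀ (α : Fin 4 → Fin 4 → Fin 4 → ℤ × ℤ × ℤ → ℝ) (X₀ : Fin 4 → ℝ),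
          InTableClass R α → ‖X₀‖ = 1 → ¬ NoGlobalCascade ε₀ α X₀ := by
  constructor
  · intro h R hR
    obtain ⟨εR, hεR, H⟩ := h R hR
    exact ⟨εR, hεR, fun ε₀ hε hle α X₀ hα _ => H ε₀ hε hle α X₀ hα⟩
  · intro h R hR
    obtain ⟨εR, hεR, H⟩ := h R hR
    refine ⟨εR, hεR, fun ε₀ hε hle α X₀ hα hNG => ?_⟩
    have hX₀ : X₀ ≠ 0 := (live_of_noGlobalCascade hε hα hNG).2
    have hpos : 0 < ‖X₀‖⁻¹ := inv_pos.2 (norm_pos_iff.2 hX₀)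
    exact H ε₀ hε hle α (fun i => ‖X₀‖⁻¹ * X₀ i) hα (norm_normalise_eq_one hX₀)
      ((noGlobalCascade_datumScale_iff hε hpos).2 hNG)

end BlowupRigidityOne

end Summit.NavierStokesRegularity.NavierStokesRegularity.Theorems

end
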